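import Summits.QuantumFields.YangMills.Theses.UniversalDetector
import Summits.QuantumFields.YangMills.Theorems.UniversalDetectorBlindDetectorOfExtraction
import Summits.QuantumFields.YangMills.Theorems.UniversalDetectorBlindSeqExtraction

/-!
# `UniversalDetector.BlindDetector` (item stmt-QuantumFields-24148) — proof

Support item of LINE g11-1 «blind detector» (planner ym-idea-8 g11) on route `UniversalDetector` (YangMills, rung R2a,
crux `BalabanLadder.NT` = stmt-QuantumFields-19353).  THE BLIND UNIVERSAL DETECTOR: for every compact simple `G`, every
`r` and unit `a → 0` satisfying the conclusions of `HankelCeiling` and `HankelLongitudinal` and NONCONTACT_Ω, clause (i) of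
`LowerBounds G r a` holds.

Three-line closing file: the planner's Theorems-side composition `blindDetector_of_blindSeqExtraction` (✓p707667;
`BlindSeqExtraction → BlindDetector`, with ym-line-sfw-p2-w4's landed `BlindDetectorRigidity` ✓p705845 plugged in) applied
to the fleet lead's landed extraction `Cruxes.UniversalDetectorBlindExtraction.blindSeqExtraction` (✓p707587, ym-spine-19353-p1
g26: orthant modulus + gauge Arzelà–Ascoli + hyperplane cutoffs).

HONEST FRAMING: a support item; the cruxes `SchemeEdgeBit` (24146) / `SchemeCurvatureLaws` (24087), the residual
`SkewAtEdgeScheme` (24149), the rung `BalabanLadder.NT` and every summit statement remain open; the Yang–Mills mass gap is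
NOT proved by this. [folklore]
-/

set_option autoImplicit false

namespace Summit.QuantumFields.YangMills.Theorems

/-- **`UniversalDetector.BlindDetector` holds** (item stmt-QuantumFields-24148, BY NAME): blind sequential extraction +
blind detector rigidity + the universal detector. [folklore] -/
theorem universalDetector_blindDetector_proof :
    Summit.QuantumFields.YangMills.Theses.UniversalDetector.BlindDetector :=
  Summit.QuantumFields.YangMills.Cruxes.UniversalDetectorBlindDetector.blindDetector_of_blindSeqExtraction
    Summit.QuantumFields.YangMills.Cruxes.UniversalDetectorBlindExtraction.blindSeqExtraction

end Summit.QuantumFields.YangMills.Theorems
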